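import Summits.QuantumAdvantage.QuantumAdvantage.Theorems.SosSandwichTransferPBDescentDefs
import Summits.QuantumAdvantage.QuantumAdvantage.Theorems.SosSandwichTransferPBMachineSplitKept
import Summits.QuantumAdvantage.QuantumAdvantage.Theorems.SosSandwichTransferPBMachineEncodings
import HarnessLib

/-!
# Crux `TransferPB` (stmt-QuantumAdvantage-15238, route SosSandwich), line `birth` — the heavy-prefix DESCENT is a kept-sound advisor

Machine half of stub `stub_pbOracleSimulation`, after the corrected split
`Theorems/SosSandwichTransferPBMachineSplitKept.lean` (`stub_pbOracleSimulation_of_keptMachines`: one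
polynomial-time transcript machine realising, for every answer function `g` CONSISTENT with the node-test
promise problem, SOME kept-sound advisor with SOME budget `≥ machineBudget`). The reference algorithm is fixed in
`Theorems/SosSandwichTransferPBDescentDefs.lean` (`liveLevel`, `descentCands`, `descentPick`, `descentAdvisor`).
This file proves, for EVERY answer function (no consistency needed):

* `length_of_mem_liveLevel`, `prefixes_of_mem_liveLevel`, `mem_liveLevel_of_prefixes` — level `j` of the
  descent lists exactly the strings of length `j` all of whose prefixes the block test answers `true`
  (membership characterisation; as a list it may be traversed in the machine's order);
* `descentPick_some_spec` / `descentPick_none_spec` — a pick is an unrevealed string of length `< W` passing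
  all its prefix-block tests and its single test, of least canonical number (`strNum_descentPick_le`); a
  refusal certifies that no such string exists;
* `descentAdvisor_pick_some`, `descentAdvisor_pick_none`, `descentAdvisor_val_eq` — **the descent advisor is
  kept-sound** in the sense of `stub_pbOracleSimulation_of_keptMachines`;
* **`stub_pbOracleSimulation_of_descentMachines`** — hence the stub follows from (Q) and (M_desc): a
  polynomial-time transcript machine whose run with `A ⊕ g` on `x` (`n ≥ 1`, `g` consistent) is the threshold
  bit of `advTree (descentAdvisor F x g) D []` at the bits of `A`, for some `D ≥ machineBudget F x r c k`.

What then remains of the machine half is purely an IMPLEMENTATION statement (the transcript machine performs the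
descent's BLOCK/SINGLE queries level by level, one `A`-query per round, forty MEAN queries, within a polynomial
round budget — the live levels have `≤ 8T²/w` members under consistency,
`Theorems/SosSandwichTransferPBDescentBound.lean`).
Sources: S. Aaronson, A. Ambainis, Theory Comput. 10 (2014), proof of Thm. 23 (p. 14); C. H. Bennett,
E. Bernstein, G. Brassard, U. Vazirani, SIAM J. Comput. 26 (1997), Cor. 3.4.
-/

-- D-0017: single-conjunct summit ⇒ the duplicate `QuantumAdvantage.QuantumAdvantage` is mandated.
set_option linter.dupNamespace false

noncomputable section

namespace Summit.QuantumAdvantage.QuantumAdvantage.Cruxes.TransferPB.Birth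

open Finset MeasureTheory Literature.Computability.Cryptography Literature.Computability.Complexity
  Literature.Computability.QuantumComplexity Literature.Computability.QuantumComplexity.ClassicalSimulation
open Summit.QuantumAdvantage.QuantumAdvantage.Theses.SosSandwich
open scoped ENNReal

namespace SimTreePB

section LiveLemmas

variable {blk sgl : List Bool → Bool}

/-- Live strings of level `j` have length `j`. [folklore] -/
theorem length_of_mem_liveLevel : ∀ {j : ℕ} {u : List Bool}, u ∈ liveLevel blk j → u.length = j
  | 0, u, h => by
    unfold liveLevel at h
    split_ifs at h with hb
    · simp only [List.mem_singleton] at h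
      simp [h]
    · simp at h
  | j + 1, u, h => by
    unfold liveLevel at h
    simp only [List.mem_flatMap, List.mem_filter, List.mem_cons, List.not_mem_nil, or_false] at h
    obtain ⟨v, hv, huv, -⟩ := h
    have := length_of_mem_liveLevel hv
    rcases huv with rfl | rfl <;> simp [this]

/-- Live strings are answered `true`. [folklore] -/
theorem blk_of_mem_liveLevel : ∀ {j : ℕ} {u : List Bool}, u ∈ liveLevel blk j → blk u = true
  | 0, u, h => by
    unfold liveLevel at h
    split_ifs at h with hb
    · simp only [List.mem_singleton] at h
      simpa [h] using hb
    · simp at h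
  | j + 1, u, h => by
    unfold liveLevel at h
    simp only [List.mem_flatMap, List.mem_filter, List.mem_cons, List.not_mem_nil, or_false] at h
    obtain ⟨v, -, -, hb⟩ := h
    simpa using hb

/-- The parent of a live string of level `j+1` is live at level `j`. [folklore] -/
theorem mem_liveLevel_succ_iff {j : ℕ} {u : List Bool} :
    u ∈ liveLevel blk (j + 1) ↔ ∃ v b, u = v ++ [b] ∧ v ∈ liveLevel blk j ∧ blk u = true := by
  conv_lhs => unfold liveLevel
  simp only [List.mem_flatMap, List.mem_filter, List.mem_cons, List.not_mem_nil, or_false,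
    decide_eq_true_eq]
  constructor
  · rintro ⟨v, hv, huv, hb⟩
    rcases huv with rfl | rfl
    · exact ⟨v, false, rfl, hv, hb⟩
    · exact ⟨v, true, rfl, hv, hb⟩
  · rintro ⟨v, b, rfl, hv, hb⟩
    refine ⟨v, hv, ?_, hb⟩
    cases b
    · exact Or.inl rfl
    · exact Or.inr rfl

/-- **A string all of whose prefixes are answered `true` is live at its own level.** [cite: BennettBernsteinBrassardVazirani1997, Cor. 3.4] -/
theorem mem_liveLevel_of_prefixes (u : List Bool) (h : ∀ i : ℕ, i ≤ u.length → blk (u.take i) = true) :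
    u ∈ liveLevel blk u.length := by
  induction u using List.reverseRecOn with
  | nil =>
    have h0 := h 0 le_rfl
    simp only [List.take_zero] at h0
    unfold liveLevel
    simp [h0]
  | append_singleton v b ih =>
    rw [List.length_append, List.length_singleton, mem_liveLevel_succ_iff]
    refine ⟨v, b, rfl, ih fun i hi => ?_, ?_⟩
    · have := h i (by simp; omega)
      rwa [List.take_append_of_le_length hi] at this
    · have := h (v.length + 1) (by simp)
      rwa [List.take_of_length_le (by simp)] at this

/-- All prefixes of a live string are answered `true`. [folklore] -/
theorem prefixes_of_mem_liveLevel : ∀ {j : ℕ} {u : List Bool}, u ∈ liveLevel blk j →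
    ∀ i : ℕ, i ≤ j → blk (u.take i) = true
  | 0, u, h, i, hi => by
    have hu := length_of_mem_liveLevel h
    have hb := blk_of_mem_liveLevel h
    rw [List.length_eq_zero_iff] at hu
    subst hu
    simpa using hb
  | j + 1, u, h, i, hi => by
    obtain ⟨v, b, rfl, hv, hb⟩ := mem_liveLevel_succ_iff.1 h
    have hlv := length_of_mem_liveLevel hv
    rcases Nat.lt_or_ge i (j + 1) with hlt | hge
    · rw [List.take_append_of_le_length (by omega)]
      exact prefixes_of_mem_liveLevel hv i (by omega)
    · rwa [List.take_of_length_le (by simp; omega)]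

/-- Membership in the candidate list. [folklore] -/
theorem mem_descentCands_iff {W : ℕ} {used : List (List Bool)} {u : List Bool} :
    u ∈ descentCands blk sgl W used ↔
      u.length < W ∧ u ∈ liveLevel blk u.length ∧ sgl u = true ∧ u ∉ used := by
  unfold descentCands
  simp only [List.mem_filter, List.mem_flatMap, List.mem_range, decide_eq_true_eq]
  constructor
  · rintro ⟨⟨j, hj, hu⟩, hs, hn⟩
    have := length_of_mem_liveLevel hu
    subst this
    exact ⟨hj, hu, hs, hn⟩
  · rintro ⟨hj, hu, hs, hn⟩
    exact ⟨⟨u.length, hj, hu⟩, hs, hn⟩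

/-- **What a pick certifies**: a live string of length `< W` (all prefix blocks answered `true`) whose single
test is answered `true` and which is not yet revealed. [folklore] -/
theorem descentPick_some_spec {W : ℕ} {used : List (List Bool)} {u : List Bool}
    (h : descentPick blk sgl W used = some u) :
    u.length < W ∧ (∀ i : ℕ, i ≤ u.length → blk (u.take i) = true) ∧ sgl u = true ∧ u ∉ used := by
  unfold descentPick at h
  have hm : u ∈ descentCands blk sgl W used := List.argmin_mem (Option.mem_def.2 h)
  obtain ⟨hW, hl, hs, hn⟩ := mem_descentCands_iff.1 hm
  exact ⟨hW, prefixes_of_mem_liveLevel hl, hs, hn⟩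

/-- A pick minimises the canonical number among the candidates. [folklore] -/
theorem strNum_descentPick_le {W : ℕ} {used : List (List Bool)} {u : List Bool}
    (h : descentPick blk sgl W used = some u) {v : List Bool} (hv : v ∈ descentCands blk sgl W used) :
    strNum u ≤ strNum v := by
  unfold descentPick at h
  exact List.le_of_mem_argmin hv (Option.mem_def.2 h)

/-- **What a refusal certifies**: no unrevealed string of length `< W` passes all its prefix-block tests and
its single test. [cite: BennettBernsteinBrassardVazirani1997, Cor. 3.4] -/
theorem descentPick_none_spec {W : ℕ} {used : List (List Bool)} (h : descentPick blk sgl W used = none)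
    {u : List Bool} (hW : u.length < W) (hn : u ∉ used) (hs : sgl u = true)
    (hp : ∀ i : ℕ, i ≤ u.length → blk (u.take i) = true) : False := by
  have hnil : descentCands blk sgl W used = [] := List.argmin_eq_none.1 h
  have hm : u ∈ descentCands blk sgl W used :=
    mem_descentCands_iff.2 ⟨hW, mem_liveLevel_of_prefixes u hp, hs, hn⟩
  rw [hnil] at hm
  exact List.not_mem_nil hm

end LiveLemmas

section AdvLemmas

variable {F : QCircuitFamily cliffordT} {x : List Bool} {g : List Bool → Bool}

/-- `encSingle` is `encSingleStr` of the bit's string. [folklore] -/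
theorem encSingle_eq_encSingleStr (ρ : List (Fin (numOracleBits F x) × Bool)) (s : Fin (numOracleBits F x)) :
    encSingle F x ρ s = encSingleStr F x ρ (bitString F x s) := rfl

/-- Relevant strings are short. [folklore] -/
theorem length_bitString_lt (s : Fin (numOracleBits F x)) : (bitString F x s).length < oracleWidth F x :=
  mem_shortStrings.1 ((bitEquiv F x).symm s).2

/-- The string of the bit named by a short string. [folklore] -/
theorem bitString_bitEquiv {u : List Bool} (h : u.length < oracleWidth F x) :
    bitString F x (bitEquiv F x ⟨u, mem_shortStrings.2 h⟩) = u := by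
  unfold bitString
  rw [Equiv.symm_apply_apply]

/-- A bit is revealed on `ρ` iff its string is among the revealed strings. [folklore] -/
theorem mem_map_bitString_iff (ρ : List (Fin (numOracleBits F x) × Bool)) (s : Fin (numOracleBits F x)) :
    bitString F x s ∈ ρ.map (fun e => bitString F x e.1) ↔ s ∈ ρ.map Prod.fst := by
  simp only [List.mem_map]
  constructor
  · rintro ⟨e, he, hs⟩
    exact ⟨e, he, bitString_injective F x hs⟩
  · rintro ⟨e, he, rfl⟩
    exact ⟨e, he, rfl⟩

/-- **Picks of the descent advisor** are free bits whose SINGLE test `g` answers `true` (for EVERY `g`).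
[cite: AaronsonAmbainis2014, Thm. 23 (proof, p. 14)] -/
theorem descentAdvisor_pick_some {ρ : List (Fin (numOracleBits F x) × Bool)} {s : Fin (numOracleBits F x)}
    (h : (descentAdvisor F x g).pick ρ = some s) : s ∉ ρ.map Prod.fst ∧ g (encSingle F x ρ s) = true := by
  unfold descentAdvisor at h
  dsimp only at h
  split at h
  · exact absurd h (by simp)
  · rename_i u hu
    split_ifs at h with hW
    simp only [Option.some.injEq] at h
    subst h
    obtain ⟨-, -, hs, hn⟩ := descentPick_some_spec hu
    rw [encSingle_eq_encSingleStr, ← mem_map_bitString_iff, bitString_bitEquiv hW]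
    exact ⟨hn, hs⟩

/-- **Refusals of the descent advisor** happen only when no free bit is `Kept` (for EVERY `g`).
[cite: BennettBernsteinBrassardVazirani1997, Cor. 3.4] -/
theorem descentAdvisor_pick_none {ρ : List (Fin (numOracleBits F x) × Bool)}
    (h : (descentAdvisor F x g).pick ρ = none) :
    ∀ s : Fin (numOracleBits F x), s ∉ ρ.map Prod.fst → ¬ Kept F x g ρ s := by
  intro s hs hkept
  unfold descentAdvisor at h
  dsimp only at h
  split at h
  · rename_i hnone
    refine descentPick_none_spec hnone (length_bitString_lt s) ?_ ?_ hkept.1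
    · rwa [mem_map_bitString_iff]
    · rw [← encSingle_eq_encSingleStr]; exact hkept.2
  · rename_i u hu
    split_ifs at h with hW
    exact hW (descentPick_some_spec hu).1

/-- The descent advisor's leaf value is the MEAN count. [folklore] -/
theorem descentAdvisor_val_eq (ρ : List (Fin (numOracleBits F x) × Bool)) :
    (descentAdvisor F x g).val ρ = (((Icc 1 40).filter fun j => g (encMean F x ρ j) = true).card : ℝ) / 40 := rfl

end AdvLemmas

/-! ### The stub from (Q) and a machine running the descent -/

/-- **`stub_pbOracleSimulation` from (Q) and (M_desc).** If (Q) `nodeProblem F r c k ∈ PromiseBQP` for all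
`c, k`, uniform `F`, `r`, and (M_desc) for the same data ONE polynomial-time transcript machine `C` (query
lengths `≤ q(n)`) satisfies: for every `x` with `n ≥ 1` and every `g` CONSISTENT with `nodeProblem F r c k`
there is a budget `D ≥ machineBudget F x r c k` with `C^{A ⊕ g}(x) =` the threshold bit of
`advTree (descentAdvisor F x g) D []` at the relevant bits of `A`, for every `A` — then the registered stub
`Sig.stub_pbOracleSimulation` holds. [cite: AaronsonAmbainis2014, Thm. 23 (proof, p. 14)] -/
theorem stub_pbOracleSimulation_of_descentMachines
    (hQ : ∀ (c k : ℕ) (F : QCircuitFamily cliffordT), F.IsUniform → ∀ r : Polynomial ℕ,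
      nodeProblem F r c k ∈ Literature.Computability.Cryptography.PromiseBQP)
    (hM : ∀ (c k : ℕ) (F : QCircuitFamily cliffordT), F.IsUniform → ∀ r : Polynomial ℕ,
      ∃ (C : OracleAlg Bool) (q : Polynomial ℕ),
        C.IsPolyTime Computability.encodingBoolBool ∧
        (∀ (O : Oracle) (x : List Bool), ∀ y ∈ C.queries O (q.eval x.length) x, y.length ≤ q.eval x.length) ∧
        ∀ x : List Bool, 1 ≤ x.length → ∀ g : List Bool → Bool,
          (∀ v ∈ (nodeProblem F r c k).yes, g v = true) → (∀ v ∈ (nodeProblem F r c k).no, g v = false) →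
          ∃ D : ℕ, machineBudget F x r c k ≤ D ∧
            ∀ A : Set (List Bool),
              C.run (Oracle.ofLanguage {w : List Bool | ∃ v : List Bool,
                  (w = false :: v ∧ v ∈ A) ∨ (w = true :: v ∧ g v = true)}) (q.eval x.length) x =
                some (decide (1 / 2 ≤
                  (advTree (descentAdvisor F x g) D []).eval (oracleBits F x A)))) :
    Sig.stub_pbOracleSimulation := by
  refine stub_pbOracleSimulation_of_keptMachines hQ fun c k F hF r => ?_
  obtain ⟨C, q, hCpoly, hCq, hrun⟩ := hM c k F hF r
  refine ⟨C, q, hCpoly, hCq, fun x hx g hgy hgn => ?_⟩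
  obtain ⟨D, hD, hrunA⟩ := hrun x hx g hgy hgn
  exact ⟨descentAdvisor F x g, D, hD, fun ρ s h => descentAdvisor_pick_some h,
    fun ρ h => descentAdvisor_pick_none h, descentAdvisor_val_eq, hrunA⟩

end SimTreePB

end Summit.QuantumAdvantage.QuantumAdvantage.Cruxes.TransferPB.Birth

end
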